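import Mathlib
import Summits.KontsevichZagierPeriods.Zeta5Search.AtlasCellRecB
import Summits.KontsevichZagierPeriods.Zeta5Search.UniversalDigitCells
import Summits.KontsevichZagierPeriods.Zeta5Search.CasoratianClassBoundShift
import Summits.KontsevichZagierPeriods.Zeta5Search.RecordCellAAtlasNotMin
import Summits.KontsevichZagierPeriods.Zeta5Search.LevelClassDigits
import HarnessLib

/-!
# ζ(5) search — gen-2 g9's `RecordCellBClassData` and `RecordCellBBonus` BY NAME (HONEST FRAMING: systematic search; no irrationality claim unless certified)

Cell `pub-zeta5`, GEN-2 seat generation 19.  gen-2 g9 typed the class structure of the RECORD cell B (`12n < p < 12.5n` on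
`b(n) = n·(41; 17,…,11)`, REPORT-gen2-g9 §6.4 (B1)–(B4)) as `ClusterValuation.RecordCellBClassData` and the first-digit bonus as
`ClusterValuation.RecordCellBBonus` (`casLB + 1 ≤ v_p(Cas₇)`).  Both were left `@[conjecture]` when census g11's `CellAtlas.RecordCellB` itself
became a theorem through P1 g8's atlas machine (`AtlasCellRecBP1/P2`, `AtlasCellRecB.holds`).  This file reads both statements off that machine
output, exactly as P1 g6's `RecordCellDClassDataProof` did for cell D from the hand atlas: the class exponents are `≥ −5` (`AtlasCellRecB.exp_ge`),
the class of `12n` is a multipole class of exponent `−5` (the body of `AtlasCellRecB.witness`), every deep class is a centre-free bare three-point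
class of one of the four types `(−1,−5,1)`, `(1,−5,−1)`, `(0,−6,1)`, `(1,−6,0)` (`AtlasCellRecB.deep_types` + `LevelClass.classSet_level`), hence
**`casLB (bRec n) p = −7`** (`VB = −5`, `rowMin = 3 − 5 = −2`, by reading the `List.min?` definitions as in `CellD.casLB_bRecD`), and the bonus is
`AtlasCellRecB.holds` (`v ≥ −6 = casLB + 1`).  `p`-adic bookkeeping of explicit rationals; nothing here bears on irrationality.
-/

open Finset

namespace Summit.KontsevichZagierPeriods.Zeta5Search.RecordCellBData

open Summit.KontsevichZagierPeriods.Zeta5Search.ClusterValuation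
open Summit.KontsevichZagierPeriods.Zeta5Search.CasoratianValuation (InPolytope shift casoratian)
open Summit.KontsevichZagierPeriods.Zeta5Search.WedgeDictionary (dOf)
open Summit.KontsevichZagierPeriods.Zeta5Search.CellKit
open Summit.KontsevichZagierPeriods.Zeta5Search.CellA (classExp_le_classNu)
open Summit.KontsevichZagierPeriods.Zeta5Search.AtlasRayRecord
open Summit.KontsevichZagierPeriods.Zeta5Search.AtlasCellRecB

variable {p : ℕ} [hp : Fact p.Prime]

/-! ### §1 The class of `12n` (the body of `AtlasCellRecB.witness`, with the residue made explicit) -/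

set_option maxHeartbeats 800000 in
/-- `x = 12n` is a multipole class of exponent `−5` for every prime of the cell. -/
theorem witness12 {n : ℕ} (h1 : 12 * n < p) (h2 : 2 * p < 25 * n) :
    12 * n ∈ multipoleClasses (bLin (11 * n) (7 * n) n) p ∧ classExp (bLin (11 * n) (7 * n) n) p (12 * n) = -5 := by
  have h0 : (0 : ℤ) ≤ (bLin (11 * n) (7 * n) n) 0 := by rw [b0_int]; positivity
  have hx : 12 * n < p := by omega
  have hL1 : 12 * n + 2 * p ≤ ((bLin (11 * n) (7 * n) n) 0).toNat := by rw [b0_toNat]; omega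
  have hL2 : ((bLin (11 * n) (7 * n) n) 0).toNat < 12 * n + 2 * p + p := by rw [b0_toNat]; omega
  have hF := pointFacts n p (12 * n)
  have c2 : 12 * n ≤ (12 * n) := by omega
  have c3 : (12 * n) < 13 * n := by omega
  have c4 : 24 * n < (12 * n) + p := by omega
  have c5 : (12 * n) + p ≤ 25 * n := by omega
  have c6 : 30 * n < (12 * n) + 2 * p := by omega
  have e0 : netExp (bLin (11 * n) (7 * n) n) ((12 * n)) = (-1) := hF.2.2.1 c2 c3
  have e1 : netExp (bLin (11 * n) (7 * n) n) ((12 * n) + p) = (-5) := hF.2.2.2.2.2.2.2.2.1 c4 c5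
  have e2 : netExp (bLin (11 * n) (7 * n) n) ((12 * n) + 2 * p) = 1 := hF.2.2.2.2.2.2.2.2.2.2.2.1 c6
  have hc : ¬ CentreIn (bLin (11 * n) (7 * n) n) p (12 * n) := by
    rw [centreIn_iff_last (bLin (11 * n) (7 * n) n) (L := 2) hx hL1 hL2 h0, b0_toNat]; omega
  refine ⟨Finset.mem_filter.2 ⟨Finset.mem_range.2 hx, ?_⟩, ?_⟩
  · rw [CellD.classPoleCount_level (bLin (11 * n) (7 * n) n) (L := 2) hx hL1 hL2 tau2 (fun k hk => by interval_cases k <;> norm_num [tau2, e0, e1, e2])]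
    decide
  · rw [classExp_L2 (p := p) (n := n) (x := 12 * n) hx (by omega) (by omega), if_neg (fun h => hc h.2), e0, e1, e2]
    norm_num

/-! ### §2 `casLB = −7` on the cell -/

/-- **`casLB (b(n)) p = −7`** for `12n < p < 12.5n`: `VB = −5` (attained at the class of `12n`; every pole class has `ν ≥ E ≥ −5`) and
`rowMin = 3 + (−5) = −2` (single-pole rows give `1`, the excess row is absent or `0`). -/
theorem casLB_recB {n : ℕ} (h1 : 12 * n < p) (h2 : 2 * p < 25 * n) (hp2 : p % 2 = 1) : casLB (bLin (11 * n) (7 * n) n) p = -7 := by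
  obtain ⟨hx₀m, hE⟩ := witness12 (p := p) h1 h2
  have hx₀p : 12 * n < p := h1
  have hcnt : 2 ≤ classPoleCount (bLin (11 * n) (7 * n) n) p (12 * n) := (Finset.mem_filter.1 hx₀m).2
  have hpole : 1 ≤ classPoleCount (bLin (11 * n) (7 * n) n) p (12 * n) := by omega
  obtain ⟨v, hv⟩ := vbMin_isSome (bLin (11 * n) (7 * n) n) hx₀p hpole
  obtain ⟨r, hr⟩ := rowMin_isSome (bLin (11 * n) (7 * n) n) hx₀p hpole
  have hLB : casLB (bLin (11 * n) (7 * n) n) p = v + r := by simp [casLB, hv, hr]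
  have hν₀ : classNu (bLin (11 * n) (7 * n) n) p (12 * n) = -5 := by
    unfold classNu; rw [if_neg (fun h => by omega), hE]
  have hv1 : v ≤ -5 := by have := vbMin_le (bLin (11 * n) (7 * n) n) hv hx₀p hpole; rwa [hν₀] at this
  have hr1 : r ≤ -2 := by have := rowMin_le_multi (bLin (11 * n) (7 * n) n) hr hx₀p hcnt; rw [hE] at this; omega
  have hv2 : -5 ≤ v := by
    obtain ⟨hmem, -⟩ := List.min?_eq_some_iff.1 hv
    obtain ⟨y, hy, rfl⟩ := List.mem_map.1 hmem
    obtain ⟨hyp, -⟩ := List.mem_filter.1 hy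
    rw [List.mem_range] at hyp
    exact (exp_ge (p := p) h1 h2 hp2 hyp).trans (classExp_le_classNu _ _ _)
  have hr2 : -2 ≤ r := by
    obtain ⟨hmem, -⟩ := List.min?_eq_some_iff.1 hr
    rcases List.mem_append.1 hmem with h | h
    · obtain ⟨y, hy, hz⟩ := List.mem_filterMap.1 h
      rw [List.mem_range] at hy
      by_cases hc1 : classPoleCount (bLin (11 * n) (7 * n) n) p y = 1
      · rw [if_pos hc1] at hz; simp at hz; omega
      · rw [if_neg hc1] at hz
        by_cases hc2 : 2 ≤ classPoleCount (bLin (11 * n) (7 * n) n) p y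
        · rw [if_pos hc2] at hz
          simp at hz
          have := exp_ge (p := p) h1 h2 hp2 hy
          omega
        · rw [if_neg hc2] at hz; simp at hz
    · split_ifs at h with hd
      · simp at h; omega
      · simp at h
  omega

/-! ### §3 The deep classes: bare three-point classes of the four types -/

/-- Every class of exponent `−5` is centre-free, equals `{x, x+p, x+2p}`, and has one of the four census types. -/
theorem deep_class {n x : ℕ} (h1 : 12 * n < p) (h2 : 2 * p < 25 * n) (hp2 : p % 2 = 1) (hx : x < p)
    (hE : classExp (bLin (11 * n) (7 * n) n) p x = -5) :
    ¬ CentreIn (bLin (11 * n) (7 * n) n) p x ∧ classSet (bLin (11 * n) (7 * n) n) p x = {x, x + p, x + 2 * p} ∧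
      ((netExp (bLin (11 * n) (7 * n) n) x = -1 ∧ netExp (bLin (11 * n) (7 * n) n) (x + p) = -5 ∧
          netExp (bLin (11 * n) (7 * n) n) (x + 2 * p) = 1) ∨
       (netExp (bLin (11 * n) (7 * n) n) x = 1 ∧ netExp (bLin (11 * n) (7 * n) n) (x + p) = -5 ∧
          netExp (bLin (11 * n) (7 * n) n) (x + 2 * p) = -1) ∨
       (netExp (bLin (11 * n) (7 * n) n) x = 0 ∧ netExp (bLin (11 * n) (7 * n) n) (x + p) = -6 ∧
          netExp (bLin (11 * n) (7 * n) n) (x + 2 * p) = 1) ∨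
       (netExp (bLin (11 * n) (7 * n) n) x = 1 ∧ netExp (bLin (11 * n) (7 * n) n) (x + p) = -6 ∧
          netExp (bLin (11 * n) (7 * n) n) (x + 2 * p) = 0)) := by
  obtain ⟨hcen, L, e, hL, hL', he, hmap⟩ := deep_types (p := p) h1 h2 hp2 hx hE
  have hLen : L = 2 := by
    rcases hmap with h | h | h | h <;> · have := congrArg List.length h; simpa using this
  subst hLen
  have e0 := he 0 (by omega); have e1 := he 1 (by omega); have e2 := he 2 (by omega)
  simp only [zero_mul, add_zero, one_mul] at e0 e1
  refine ⟨hcen, ?_, ?_⟩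
  · rw [LevelClass.classSet_level (bLin (11 * n) (7 * n) n) hx hL hL']
    ext s
    simp only [mem_image, mem_range, mem_insert, mem_singleton]
    constructor
    · rintro ⟨k, hk, rfl⟩
      interval_cases k <;> simp
    · rintro (rfl | rfl | rfl)
      exacts [⟨0, by omega, by ring⟩, ⟨1, by omega, by ring⟩, ⟨2, by omega, by ring⟩]
  · have hl : (List.range (2 + 1)).map e = [e 0, e 1, e 2] := by simp [List.range_succ]
    rw [hl] at hmap
    simp only [List.reverse_cons, List.reverse_nil, List.nil_append, List.cons_append, List.cons.injEq, and_true] at hmap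
    rw [e0, e1, e2]
    rcases hmap with ⟨a, b, c⟩ | ⟨a, b, c⟩ | ⟨a, b, c⟩ | ⟨a, b, c⟩
    · exact Or.inl ⟨a, b, c⟩
    · exact Or.inr (Or.inl ⟨a, b, c⟩)
    · exact Or.inr (Or.inr (Or.inl ⟨a, b, c⟩))
    · exact Or.inr (Or.inr (Or.inr ⟨a, b, c⟩))

/-! ### §4 gen-2 g9's two statements, by name -/

/-- **`ClusterValuation.RecordCellBClassData` (gen-2 g9, REPORT-gen2-g9 §6.4) is a THEOREM.** -/
theorem recordCellBClassData_holds : RecordCellBClassData := by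
  intro n p hn2 hprime hp24 hp25
  haveI : Fact p.Prime := ⟨hprime⟩
  have h1 : 12 * n < p := by omega
  have hp2 : p % 2 = 1 := Nat.odd_iff.1 (hprime.odd_of_ne_two (by omega))
  rw [bRec_eq_bLin]
  refine ⟨casLB_recB (p := p) h1 hp25 hp2, fun x hx => exp_ge (p := p) h1 hp25 hp2 hx, witness12 (p := p) h1 hp25, ?_,
    fun x hx hE => deep_class (p := p) h1 hp25 hp2 hx hE⟩
  rw [dOf_bLin]; push_cast; omega

/-- **`ClusterValuation.RecordCellBBonus` (gen-2 g9) is a THEOREM**: `casLB + 1 = −6 ≤ v_p(Cas₇(b(n)))` on the cell (`casLB_recB` + `AtlasCellRecB.holds`). -/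
theorem recordCellBBonus_holds : RecordCellBBonus := by
  intro n p hn2 hprime hp24 hp25 hne
  have h1 : 12 * n < p := by omega
  have hp2 : p % 2 = 1 := Nat.odd_iff.1 (hprime.odd_of_ne_two (by omega))
  haveI : Fact p.Prime := ⟨hprime⟩
  have hLB : casLB (bRec n) p = -7 := by rw [bRec_eq_bLin]; exact casLB_recB (p := p) h1 hp25 hp2
  rw [hLB]
  have := AtlasCellRecB.holds n p hn2 hprime h1 hp25 hne
  push_cast
  linarith

end Summit.KontsevichZagierPeriods.Zeta5Search.RecordCellBData
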